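import Mathlib
import Literature.NumberTheory.Automorphic.HilbertModularFormQExpansion
import Summits.Langlands.Langlands.Theorems.CapacityClassicalityHilbertIntegralOverconvergentIsCongruenceStubCounts
import Summits.Langlands.Langlands.Theorems.CapacityClassicalityHilbertIntegralOverconvergentIsCongruenceStubSpanSupNorm
import Summits.Langlands.Langlands.Theorems.CapacityClassicalityHilbertIntegralOverconvergentIsCongruenceStubIntegralKernel

/-!
# Hilbert classicality modulo the named facts, part 1: the sup-norm Sturm principle for the graded family of the
# engine instance, and the affine Sturm line (line `Sketch-ideate-r1-k1`, § T, crux stmt-Langlands-8485)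

Helpers of the end-to-end assembly `hilbertClassicalityModuloNamedFacts` (file `…HilbertClassicality.lean`):

* `hcm_sturmFamily` — NAMED FACT (i) of the crux NOTES (the `p`-adic sup-norm Sturm bound for SINGLE `E`-rational Hilbert
  modular forms on the trace window `{Tr(αν) < L(b)}`) implies the sup-norm principle on the total-degree window `{|n| < L(b)}`
  for every element of the `ℚ̄_p`-SPAN `V b` of the `v`-images of the `E`-rational encoded `q`-expansions of `M_b(Γ₁(𝔫))` — the
  hypothesis `hSturm` of the abstract engine `stub_abstractEngineMain`.  Proof: the `E`-rational encodings form an `E`-subspace on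
  which (i) reads as the single-form principle on the finite window (`stub_counts`); the maximal-minor kernel
  `stub_integralKernel` and `stub_spanSupNorm` push it to the span.
* `hcm_affineLine` — a window length affine in `∑_σ |b_σ|` is affine along the rays `D • w₀ + M • t`, with positive slope in `M`
  when `t ≠ 0` (the engine's `hL`, `hct`).
* `hcm_nsmul_weight` — the weight bookkeeping `(D - j) • w₀ + j • (w₀ - k) = D • w₀ - j • k`.
-/

set_option linter.dupNamespace false

noncomputable section

namespace Summit.Langlands.Langlands.Theorems.HilbertIntegralOverconvergentIsCongruence

open MeasureTheory Complex NumberField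
open Literature.NumberTheory.Automorphic Literature.NumberTheory.Automorphic.HilbertModular
open scoped MatrixGroups NumberField

/-- **The sup-norm Sturm principle for the graded family of the engine instance, from the single-form one.**  For an encoding
`enc` with the trace formula (`htrace`, `henc`) that is additive and homogeneous on `M_b(Γ₁(𝔫))`, the single-form `p`-adic
sup-norm Sturm bound `hStf` on the trace window `{Tr(αν) < L b}` implies: every `T` in the `ℚ̄_p`-span of the `v`-images of the
`E`-rational encoded forms of weight `b` whose coefficients have norm `≤ B` on the total-degree window `{|n| < L b}` has ALL
coefficients of norm `≤ B`. [folklore] -/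
theorem hcm_sturmFamily (F : Type) [Field F] [NumberField F] (𝔫 : Ideal (𝓞 F))
    (E : Type) [Field E] (τ : E →+* ℂ) (p : ℕ) [Fact p.Prime] (v : E →+* PadicAlgCl p)
    (d : ℕ) (idx : F → (Fin d →₀ ℕ)) (α : F) (enc : (Point F → ℂ) → MvPowerSeries (Fin d) ℂ)
    (htrace : ∀ ν ∈ qIndexSet F, ((∑ j, idx ν j : ℕ) : ℚ) = Algebra.trace ℚ F (α * ν))
    (henc : ∀ f : Point F → ℂ, (∀ μ ∈ qIndexSet F, MvPowerSeries.coeff (idx μ) (enc f) = fourierCoeff f μ) ∧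
      ∀ n, (∀ μ ∈ qIndexSet F, idx μ ≠ n) → MvPowerSeries.coeff n (enc f) = 0)
    (haddE : ∀ (k : (F →+* ℝ) → ℤ) (f g : Point F → ℂ), f ∈ modularForms (Bianchi.Gamma1 𝔫) k →
      g ∈ modularForms (Bianchi.Gamma1 𝔫) k → enc (f + g) = enc f + enc g)
    (hsmul : ∀ (k : (F →+* ℝ) → ℤ) (c : ℂ) (f : Point F → ℂ), f ∈ modularForms (Bianchi.Gamma1 𝔫) k →
      enc (c • f) = c • enc f)
    (L : ((F →+* ℝ) → ℤ) → ℕ)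
    (hStf : ∀ (b : (F →+* ℝ) → ℤ) (f : Point F → ℂ), f ∈ modularForms (Bianchi.Gamma1 𝔫) b →
      ∀ q : F → E, (∀ ν ∈ qIndexSet F, fourierCoeff f ν = τ (q ν)) →
      ∀ B : ℝ, 0 ≤ B →
        (∀ ν ∈ qIndexSet F, ((Algebra.trace ℚ F (α * ν) : ℚ) : ℝ) < L b → ‖v (q ν)‖ ≤ B) →
        ∀ ν ∈ qIndexSet F, ‖v (q ν)‖ ≤ B)
    (b : (F →+* ℝ) → ℤ) (T : MvPowerSeries (Fin d) (PadicAlgCl p))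
    (hT : T ∈ Submodule.span (PadicAlgCl p)
      {ψ | ∃ (A : MvPowerSeries (Fin d) E) (f : Point F → ℂ), f ∈ modularForms (Bianchi.Gamma1 𝔫) b ∧
        MvPowerSeries.map τ A = enc f ∧ ψ = MvPowerSeries.map v A})
    (B : ℝ) (hB : 0 ≤ B) (hwinT : ∀ n : Fin d →₀ ℕ, ∑ j, n j < L b → ‖MvPowerSeries.coeff n T‖ ≤ B)
    (n : Fin d →₀ ℕ) : ‖MvPowerSeries.coeff n T‖ ≤ B := by
  classical
  have hτinj : Function.Injective τ := τ.injective
  have hfin : {ν : Fin d →₀ ℕ | ∑ j, ν j < L b}.Finite := ((stub_counts d).1 (L b)).1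
  -- the `E`-structure: `E`-rational encodings of forms of weight `b`
  let VE : Submodule E (MvPowerSeries (Fin d) E) :=
    { carrier := {A | ∃ f ∈ modularForms (Bianchi.Gamma1 𝔫) b, MvPowerSeries.map τ A = enc f}
      add_mem' := by
        rintro A A' ⟨f, hf, hA⟩ ⟨g, hg, hA'⟩
        exact ⟨f + g, add_mem hf hg, by rw [map_add, hA, hA', haddE b f g hf hg]⟩
      zero_mem' := by
        refine ⟨0, zero_mem _, ?_⟩
        have h := hsmul b 0 0 (zero_mem _)
        rw [zero_smul, zero_smul] at h
        rw [map_zero, h]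
      smul_mem' := by
        rintro c₁ A ⟨f, hf, hA⟩
        refine ⟨τ c₁ • f, Submodule.smul_mem _ _ hf, ?_⟩
        rw [hsmul b (τ c₁) f hf, ← hA, MvPowerSeries.smul_eq_C_mul, map_mul, MvPowerSeries.map_C,
          MvPowerSeries.smul_eq_C_mul] }
  have hVE : ∀ A, A ∈ VE ↔ ∃ f ∈ modularForms (Bianchi.Gamma1 𝔫) b, MvPowerSeries.map τ A = enc f := fun A ↦ Iff.rfl
  have hSimage : {ψ | ∃ (A : MvPowerSeries (Fin d) E) (f : Point F → ℂ), f ∈ modularForms (Bianchi.Gamma1 𝔫) b ∧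
      MvPowerSeries.map τ A = enc f ∧ ψ = MvPowerSeries.map v A} =
      MvPowerSeries.map v '' (VE : Set (MvPowerSeries (Fin d) E)) := by
    ext ψ
    simp only [Set.mem_setOf_eq, Set.mem_image, SetLike.mem_coe, hVE]
    constructor
    · rintro ⟨A, f, hf, hA, rfl⟩
      exact ⟨A, ⟨f, hf, hA⟩, rfl⟩
    · rintro ⟨A, ⟨f, hf, hA⟩, rfl⟩
      exact ⟨A, f, hf, hA, rfl⟩
  -- (i) in coefficient currency on `VE`
  have hWb : ∀ A ∈ VE, ∀ B : ℝ, 0 ≤ B →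
      (∀ x ∈ hfin.toFinset, ‖v (MvPowerSeries.coeff x A)‖ ≤ B) → ∀ x, ‖v (MvPowerSeries.coeff x A)‖ ≤ B := by
    intro A hA B hB hwinB x
    obtain ⟨f, hf, hAf⟩ := (hVE A).1 hA
    have hcoefτ : ∀ n, τ (MvPowerSeries.coeff n A) = MvPowerSeries.coeff n (enc f) := fun n ↦ by
      rw [← hAf, MvPowerSeries.coeff_map]
    have hq : ∀ ν ∈ qIndexSet F, fourierCoeff f ν = τ (MvPowerSeries.coeff (idx ν) A) := fun ν hν ↦ by
      rw [hcoefτ, (henc f).1 ν hν]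
    have hoff : ∀ n, (∀ ν ∈ qIndexSet F, idx ν ≠ n) → MvPowerSeries.coeff n A = 0 := fun n hn ↦
      hτinj (by rw [hcoefτ, (henc f).2 n hn, map_zero])
    by_cases hx : ∃ ν ∈ qIndexSet F, idx ν = x
    · obtain ⟨ν, hν, rfl⟩ := hx
      refine hStf b f hf (fun μ ↦ MvPowerSeries.coeff (idx μ) A) hq B hB (fun μ hμ hμL ↦ hwinB _ ?_) ν hν
      rw [Set.Finite.mem_toFinset, Set.mem_setOf_eq]
      have h' : ((∑ j, idx μ j : ℕ) : ℝ) = ((Algebra.trace ℚ F (α * μ) : ℚ) : ℝ) := by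
        rw [← htrace μ hμ, Rat.cast_natCast]
      have : ((∑ j, idx μ j : ℕ) : ℝ) < L b := by rw [h']; exact hμL
      exact_mod_cast this
    · push Not at hx
      rw [hoff x hx, map_zero, norm_zero]
      exact hB
  refine stub_spanSupNorm p v (VE : Set (MvPowerSeries (Fin d) E)) hfin.toFinset (fun m ↦ ?_) T ?_ B hB
    (fun x hx ↦ hwinT x ?_) n
  · obtain ⟨κ, hκ, hrep⟩ := stub_integralKernel p v VE hfin.toFinset hWb m
    exact ⟨κ, hκ, fun A hA ↦ hrep A (by rwa [Submodule.span_eq] at hA)⟩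
  · rwa [hSimage] at hT
  · simpa [Set.Finite.mem_toFinset] using hx

/-- **The affine Sturm line.**  A window length `L b ≤ cS (∑_σ |b_σ| + 1)` is affine along the rays `D • w₀ + M • t` with a
positive slope in `M` as soon as `t ≠ 0`: `L (D • w₀ + M • t) ≤ c₀ D + ct M + c₁`, `ct > 0`. [folklore] -/
theorem hcm_affineLine {ι : Type} [Fintype ι] (L : (ι → ℤ) → ℕ) (cS : ℝ)
    (hLb : ∀ b, (L b : ℝ) ≤ cS * (∑ σ, |(b σ : ℝ)| + 1)) (w₀ t : ι → ℤ) (ht0 : t ≠ 0) :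
    ∃ c₀ ct c₁ : ℝ, 0 < ct ∧ ∀ D M : ℕ, (L (D • w₀ + M • t) : ℝ) ≤ c₀ * D + ct * M + c₁ := by
  set cS' : ℝ := max cS 1 with hcS'
  have hcS'1 : 1 ≤ cS' := le_max_right _ _
  have hLb' : ∀ b, (L b : ℝ) ≤ cS' * (∑ σ, |(b σ : ℝ)| + 1) := fun b ↦
    (hLb b).trans (mul_le_mul_of_nonneg_right (le_max_left _ _) (by positivity))
  have htsum : 0 < ∑ σ : ι, |(t σ : ℝ)| := by
    obtain ⟨σ₀, hσ₀⟩ := Function.ne_iff.1 ht0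
    exact Finset.sum_pos' (fun σ _ ↦ abs_nonneg _) ⟨σ₀, Finset.mem_univ _, abs_pos.2 (by exact_mod_cast hσ₀)⟩
  have hct : 0 < cS' * ∑ σ : ι, |(t σ : ℝ)| := mul_pos (by linarith) htsum
  refine ⟨cS' * ∑ σ : ι, |(w₀ σ : ℝ)|, cS' * ∑ σ : ι, |(t σ : ℝ)|, cS', hct, fun D M ↦ ?_⟩
  refine (hLb' _).trans ?_
  have hσ : ∀ σ : ι, |((D • w₀ + M • t) σ : ℝ)| ≤ D * |(w₀ σ : ℝ)| + M * |(t σ : ℝ)| := by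
    intro σ
    rw [Pi.add_apply, Pi.smul_apply, Pi.smul_apply]
    simp only [nsmul_eq_mul, Int.cast_add, Int.cast_mul, Int.cast_natCast]
    calc |(D : ℝ) * w₀ σ + M * t σ| ≤ |(D : ℝ) * w₀ σ| + |(M : ℝ) * t σ| := abs_add_le _ _
      _ = D * |(w₀ σ : ℝ)| + M * |(t σ : ℝ)| := by rw [abs_mul, abs_mul, Nat.abs_cast, Nat.abs_cast]
  have hsum : ∑ σ : ι, |((D • w₀ + M • t) σ : ℝ)| ≤ D * ∑ σ : ι, |(w₀ σ : ℝ)| + M * ∑ σ : ι, |(t σ : ℝ)| := by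
    rw [Finset.mul_sum, Finset.mul_sum, ← Finset.sum_add_distrib]
    exact Finset.sum_le_sum fun σ _ ↦ hσ σ
  have h := mul_le_mul_of_nonneg_left hsum (zero_le_one.trans hcS'1)
  nlinarith [h, hcS'1]

/-- **Weight bookkeeping** in an additive commutative group: `(D - j) • w₀ + j • (w₀ - k) = D • w₀ - j • k` for `j ≤ D`. [folklore] -/
theorem hcm_nsmul_weight {W : Type} [AddCommGroup W] (w₀ k : W) (D j : ℕ) (hj : j ≤ D) :
    (D - j) • w₀ + j • (w₀ - k) = D • w₀ - j • k := by
  obtain ⟨m, rfl⟩ := Nat.exists_eq_add_of_le hj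
  rw [Nat.add_sub_cancel_left, add_nsmul, nsmul_sub]
  abel

end Summit.Langlands.Langlands.Theorems.HilbertIntegralOverconvergentIsCongruence

end
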